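import Summits.AtomisticToContinuum.Crystallization.Theorems.FrustratedLawDichotomyCellHostMirror
import Summits.AtomisticToContinuum.Crystallization.Theorems.FrustratedLawDichotomyCellRemStar
import Summits.AtomisticToContinuum.Crystallization.Theorems.FrustratedLawDichotomyCellFarLabels
import Summits.AtomisticToContinuum.Crystallization.Theorems.FrustratedLawDichotomyCellHalo

/-!
# FrustratedLawDichotomy · crux `AperiodicFrustratedLawGap` (stmt-AtomisticToContinuum-27623) — THE LABELS-SCALE MASTER, CLASS H:
# (253) `lb_le_certFloorHL_trunc` PRE-COMPOSED WITH THE FAR-LABEL, MIRROR-HOST (LOCAL WINDOW) AND STAR-REMAINDER DISCHARGERS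
# (decomp-a2c hand-1 g54; companion of `…CellMasterScale`, kept apart so class-A Floor files do not import the halo door)

(253) `…CellHalo.lb_le_certFloorHL_trunc` is the class-H truncated master (half-space / halo windows): the class-A hypothesis list with the
far column `fch m ≥ ‖Y m‖·(farCol (dB m) + halfCol (dH m))` and the extra number `hE ≥ halfEnergyCol s`.  Its label set is a CUT ball, so
the mirror host column needs the LOCAL window completeness of (p860583) `hnbh_of_local` (interior labels at depth `≥ Lh m` below the cut).

★★★ `lb_le_certFloorHL_scaleLocal` — (253) with the lists of record (`ballL M z ℓ_n`, `ballL M z ℓ_r`, `mirrorNbh M mir`, explicit `MN`/`ML`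
by predicate) and the five «∀ over M» / pair-list hypotheses replaced by their predicate-level inputs exactly as in
`…CellMasterScale.lb_le_certFloorL_scaleLocal` (radii + rational `A, B`; caller's metric conversions; mirror data with LOCAL completeness
`houtL`; star table `dk/D/g` + interior witnesses `yb`).  Template-agnostic.  DEF-FREE; imports TREE `…CellHostMirror`, `…CellRemStar`,
`…CellFarLabels`, (253) `…CellHalo`; 0 sorry.  All `[folklore]`.
-/

noncomputable section

namespace Summit.AtomisticToContinuum.Crystallization.Theorems.FrustratedLawDichotomyCellMasterScaleHalo

open Metric Set RealInnerProductSpace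
open scoped BigOperators
open Summit.AtomisticToContinuum.Crystallization.Theorems.ChargedEnergyGapNegative (E3)
open Summit.AtomisticToContinuum.Crystallization.Theorems.FrustratedLawDichotomyCoherentFloorAlgebra
open Summit.AtomisticToContinuum.Crystallization.Theorems.FrustratedLawDichotomyCoherentFloor (farCol tailCol)
open Summit.AtomisticToContinuum.Crystallization.Theorems.FrustratedLawDichotomyCoherentFloorHalo (halfCol halfEnergyCol)
open Summit.AtomisticToContinuum.Crystallization.Theorems.FrustratedLawDichotomyCellFrame
open Summit.AtomisticToContinuum.Crystallization.Theorems.FrustratedLawDichotomyCellTails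
open Summit.AtomisticToContinuum.Crystallization.Theorems.FrustratedLawDichotomyCellTailsRem
open Summit.AtomisticToContinuum.Crystallization.Theorems.FrustratedLawDichotomyCellHalo (certFloorHL lb_le_certFloorHL_trunc)
open Summit.AtomisticToContinuum.Crystallization.Theorems.FrustratedLawDichotomyCellClasses (ballL)
open Summit.AtomisticToContinuum.Crystallization.Theorems.FrustratedLawDichotomyCellHostMirror
open Summit.AtomisticToContinuum.Crystallization.Theorems.FrustratedLawDichotomyCellRemInterior
open Summit.AtomisticToContinuum.Crystallization.Theorems.FrustratedLawDichotomyCellRemStar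
open Summit.AtomisticToContinuum.Crystallization.Theorems.FrustratedLawDichotomyCellFarLabels

variable {ι : Type*} [DecidableEq ι]

/-- ★★★ **THE LABELS-SCALE MASTER FOR CLASS H (local-window form).**  (253) `lb_le_certFloorHL_trunc` with the lists of record and the
five «∀ over M» / pair-list hypotheses replaced by their predicate-level inputs (far labels by radii, host column by mirror with LOCAL
completeness radii, remainder by the star table). [folklore] -/
theorem lb_le_certFloorHL_scaleLocal {M MI : Finset ι} {pos Y : ι → E3} (o : ι) {τ Rc δ L_N R_N L_D L_R s : ℝ} {dB dH : ι → ℝ}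
    (hτ0 : 0 ≤ τ) (hδ : 0 < δ)
    (hsep : ∀ z ∈ M, ∀ z' ∈ M, z ≠ z' → δ ≤ dist (pos z) (pos z')) (hMI : MI ⊆ M)
    (z : ι → Fin 3 → ℤ) {ℓA ℓn ℓN ℓD ℓr : ℤ} {A B : ℚ}
    (hMIA : ∀ x ∈ MI, ∑ i, z x i ^ 2 < ℓA) (hAN : ℓA ≤ ℓN) (h0A : 0 ≤ A) (h0B : 0 ≤ B)
    (hA : (ℓA : ℚ) ≤ A ^ 2) (hB : (ℓn : ℚ) ≤ B ^ 2) (hAB : (A + B) ^ 2 ≤ (ℓN : ℚ))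
    (MN : Finset ι) (hLN : δ / 2 ≤ L_N) (hRN : δ / 2 ≤ R_N) (hMN : MN ⊆ M.erase o)
    (hMNsup : ∀ m ∈ M, m ≠ o → ∑ i, z m i ^ 2 < ℓN → m ∈ MN)
    (hnbL : ∀ c ∈ M, ∀ x ∈ M, x ≠ c → x ∉ ballL M z ℓn c → L_N ≤ dist (pos x) (pos c))
    (hfarN : ∀ m ∈ M, ℓN ≤ ∑ i, z m i ^ 2 → R_N ≤ ‖pos m‖)
    (ML : Finset ι) (hLD : δ / 2 ≤ L_D) (hτD : τ < L_D) (hML : ML ⊆ M.erase o)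
    (hMLsup : ∀ m ∈ M, m ≠ o → ∑ i, z m i ^ 2 < ℓD → m ∈ ML) (hfarD : ∀ m ∈ M, ℓD ≤ ∑ i, z m i ^ 2 → L_D ≤ ‖pos m‖)
    (hLR : δ / 2 ≤ L_R) (hτR : 2 * τ < L_R)
    (hnbrL : ∀ m ∈ M, ∀ m' ∈ M, m' ≠ m → m' ∉ ballL M z ℓr m → L_R ≤ dist (pos m') (pos m))
    {κ : Type*} [DecidableEq κ] (dk : ι → ι → κ) (hinjdk : ∀ x ∈ MI, Set.InjOn (dk x) ↑M) (D : Finset κ) (g : κ → ℝ)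
    (hg : ∀ d ∈ D, 0 ≤ g d) (hD : ∀ x ∈ MI, ∀ m' ∈ M, m' ≠ x → m' ∈ ballL M z ℓr x → dk x m' ∈ D)
    (hwg : ∀ x ∈ MI, ∀ m' ∈ M, m' ≠ x → m' ∈ ballL M z ℓr x →
      forceRem ‖pos x - pos m'‖ (dispL o τ x + dispL o τ m') ≤ g (dk x m'))
    (yb : ι → ℝ) (hyb : ∀ x ∈ MI, ‖Y x‖ ≤ yb x)
    -- host-force pairings: THE MIRROR CORE with LOCAL completeness radii
    (mir : ι → ι → ι) (hrev : ∀ m ∈ MI, ∀ m' ∈ M, pos m - pos (mir m m') = -(pos m - pos m'))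
    (hinv : ∀ m ∈ MI, ∀ m' ∈ M, mir m (mir m m') = m') {adm : ι → Prop}
    (hadm : ∀ m ∈ MI, ∀ m' ∈ M, adm (mir m m')) (Lh : ι → ℝ) (hLh : ∀ m ∈ MI, δ / 2 ≤ Lh m)
    (houtL : ∀ m ∈ MI, ∀ x, adm x → x ∉ M → Lh m ≤ dist (pos x) (pos m))
    (host : ι → ℝ) (hhost : ∀ m ∈ M.erase o, host m ≤ phiT (‖pos m‖ ^ 2))
    (deb : ι → ℝ) (hdeb : ∀ m ∈ ML, τ ^ 2 * secondNeg ‖pos m‖ + energyRem ‖pos m‖ τ ≤ deb m)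
    (nn : ι → ℝ) (hnn : ∀ m ∈ MN, ‖psiT (‖pos m‖ ^ 2) • pos m - certCoeffNearL M MI pos Y (ballL M z ℓn) m‖ ≤ nn m)
    (hf : ι → ℝ) (hhf : ∀ m ∈ MI, ‖Y m‖ * psiTail δ (Lh m) ≤ hf m)
    (fch : ι → ℝ) (hfch : ∀ m ∈ MI, ‖Y m‖ * (farCol (dB m) + halfCol (dH m)) ≤ fch m)
    (SY : ℝ) (hSY : ∑ x ∈ MI, ‖Y x‖ ≤ SY) (tc : ℝ) (htc : tailCol Rc ≤ tc) (hE : ℝ) (hhE : halfEnergyCol s ≤ hE) :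
    ∑ m ∈ M.erase o, host m - (∑ m ∈ ML, deb m + debTail δ L_D τ)
        - τ * (∑ m ∈ MN, nn m + psiTail δ R_N + 2 * SY * linTail δ L_N)
        - ∑ m ∈ MI, hf m - ∑ m ∈ MI, fch m - ((∑ x ∈ MI, yb x) * (∑ d ∈ D, g d) + SY * remTail δ L_R τ) - tc - hE
      ≤ certFloorHL M MI o pos Y τ Rc dB dH s := by
  have hinj : Set.InjOn pos ↑M := injOn_of_sep hδ hsep
  exact lb_le_certFloorHL_trunc (M := M) (MI := MI) (pos := pos) (Y := Y) o hτ0 hδ hsep hMI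
    MN (ballL M z ℓn) hLN hRN hnbL hMN
    (hMNc_of_radii (M := M) (MI := MI) (pos := pos) (z := z) o hMNsup hMIA hAN h0A h0B hA hB hAB hfarN)
    ML hLD hτD hML (hMLc_of_radius (M := M) (pos := pos) (z := z) o hMLsup hfarD)
    (ballL M z ℓr) hLR hτR hnbrL
    (mirrorNbh M mir) Lh hLh (hnbh_of_local (MI := MI) houtL hadm hrev)
    host hhost deb hdeb nn hnn
    hf (hhf_of_mirror hinj hMI hrev hinv hhf)
    fch hfch ((∑ x ∈ MI, yb x) * ∑ d ∈ D, g d)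
    (hRM_of_star (pos := pos) (Y := Y) (nbr := ballL M z ℓr) o hτ0 hMI (ballL_hsym M z ℓr) dk hinjdk D g hg hD hwg yb hyb)
    SY hSY tc htc hE hhE

end Summit.AtomisticToContinuum.Crystallization.Theorems.FrustratedLawDichotomyCellMasterScaleHalo

end
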